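import Mathlib.Analysis.Matrix.Normed
import Mathlib.Analysis.Normed.Group.Ultra
import Mathlib.Topology.MetricSpace.Ultra.Pi
import Mathlib.Analysis.Calculus.FDeriv.Mul
import Mathlib.Analysis.Calculus.FDeriv.Prod
import Mathlib.Analysis.Calculus.FDeriv.Add
import Literature.Analysis.Calculus.CayleyTransform      -- ★ `cayley X = (1 − X) * Ring.inverse (1 + X)`, `cayley_zero`
import HarnessLib

/-!
# Matrix calculus under the ELEMENTWISE sup norm over an ultrametric field: `‖AB‖ ≤ ‖A‖‖B‖`, the strict derivative of
# `Ring.inverse`, of the Cayley transform, and of the slice map `(Y, Z) ↦ c(Y)(A + Z)c(Y)⁻¹`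

Topic `Analysis/Matrix`; namespace `Literature.Analysis.Matrix`.  KERNEL mathematics only: theorems, no definition, no named fact, no
instance, no notation, no `sorry`.  Mathlib + ★ `Literature.Analysis.Calculus.CayleyTransform`.  Written for the cell `pub/hodgecm-mathlib`
(ROAD «HC-D» of F0P2-p01 (g23), brick (U) «ULTRAMETRIC SUP-NORM MATRIX CALCULUS», seat F0P3a-p05 (g23), 2026-09-02): the road's Newton∕box
machinery (★ `Literature.Analysis.Calculus.UltrametricNewtonChart`, ★ `F0P3cStCharTSStrictDerivNewton.exists_depth_chart`) needs the SOURCE of a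
chart to carry an ULTRAMETRIC norm (closed balls = additive subgroups), which for subspaces of `M_n(K)` is Mathlib's scoped elementwise norm
(`open scoped Matrix.Norms.Elementwise`: `‖A‖ = sup_{i,j} ‖aᵢⱼ‖`), whereas Mathlib's matrix CALCULUS (`hasStrictFDerivAt_ringInverse`, the product
rule `HasStrictFDerivAt.mul'`) wants a `NormedRing`, which Mathlib only provides for the `L^∞`-operator norm `maxᵢ Σⱼ ‖aᵢⱼ‖` (not ultrametric).
Over an ULTRAMETRIC coefficient ring the elementwise norm IS submultiplicative (§1), so the `NormedRing`∕`NormedAlgebra` structures exist; they are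
built INLINE inside the proofs below (`letI`, no global instance — several matrix norms coexist in Mathlib by design) and every exported statement
mentions only the scoped elementwise `NormedAddCommGroup`∕`NormedSpace` instances, with the derivative delivered as `∃ D, (∀ v, D v = ‹formula›) ∧ …`.

* §1 `norm_mul_le_of_isUltrametricDist` — **`‖A * B‖ ≤ ‖A‖ * ‖B‖`** for rectangular matrices over a non-unital seminormed ring with
  `IsUltrametricDist` (`‖Σₖ aᵢₖbₖⱼ‖ ≤ maxₖ ‖aᵢₖ‖‖bₖⱼ‖`); `norm_pow_le_of_isUltrametricDist`.
* §2 (`K` a complete nontrivially normed field with `IsUltrametricDist K`; `n` finite):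
  `hasStrictFDerivAt_ringInverse_elementwise` — **`D(Ring.inverse)(u) = (X ↦ −u⁻¹Xu⁻¹)`**, strictly, at every unit `u` of `M_n(K)`;
  `hasStrictFDerivAt_cayley_elementwise` — **`Dc(0) = −2·id`** for the tree's Cayley transform `c(X) = (1 − X)(1 + X)⁻¹`;
  `hasStrictFDerivAt_mul_elementwise` — the product rule in `∃`-form for two `M_n(K)`-valued maps on a normed `K`-space;
  `hasStrictFDerivAt_cayleyConj_add_elementwise` — the SLICE MAP of Harish-Chandra descent in the Lie algebra,
  **`Ψ(Y, Z) = c(Y)(A + Z)c(Y)⁻¹` has strict derivative `(Y, Z) ↦ 2(AY − YA) + Z` at `(0, 0)`** (`Ring.inverse` form, total);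
  `hasStrictFDerivAt_cayleyConj_mul_elementwise` — the group-slice shape `(Y, Z) ↦ c(Y)·γc(Z)·c(Y)⁻¹`, derivative `2(γY − Yγ − γZ)`
  (★ `RegularOrbitChartUnitary`'s private slice lemma, re-derived under the elementwise norm).
* §3 `hasStrictFDerivAt_codRestrict_iff` — for a map INTO a submodule `p` (isometric inclusion), `HasStrictFDerivAt (p.subtype ∘ f) (p.subtypeL ∘L D) x
  ↔ HasStrictFDerivAt f D x` (any normed spaces; used to land the slice map in the `F`-Lie algebra `𝔲 ⊆ M_n(K)`).

## References
* [Schikhof1984] W. H. Schikhof, *Ultrametric Calculus*, Cambridge (1984), §27 (differentiable maps in several non-archimedean variables), Exercise 13.A (matrix norms).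
* [BoschGuntzerRemmert1984] S. Bosch, U. Güntzer, R. Remmert, *Non-Archimedean Analysis* (1984), §1.2.1 (the sup norm on `Kⁿ` is an ultrametric Banach norm), §3.7.
* [HarishChandra1970] Harish-Chandra, *Harmonic Analysis on Reductive p-adic Groups*, LNM 162 (1970), Part VI Lemma 22 (the slice map).
-/

set_option autoImplicit false

open scoped Matrix.Norms.Elementwise Topology
open Literature.Analysis.Calculus

namespace Literature.Analysis.Matrix

/-! ### §1 Submultiplicativity of the elementwise norm over an ultrametric coefficient ring -/

section SubMul

variable {α : Type*} [NonUnitalSeminormedRing α] [IsUltrametricDist α] {l m n : Type*} [Fintype l] [Fintype m] [Fintype n]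

/-- **`‖A * B‖ ≤ ‖A‖ * ‖B‖` for the elementwise sup norm over an ULTRAMETRIC (non-unital, semi)normed ring**: each entry of `AB` is a finite sum
`Σₖ aᵢₖ bₖⱼ`, whose norm is at most `maxₖ ‖aᵢₖ‖‖bₖⱼ‖ ≤ ‖A‖‖B‖` by the strong triangle inequality. [cite: BoschGuntzerRemmert1984, §1.2.1] [cite: Schikhof1984, Exercise 13.A] -/
theorem norm_mul_le_of_isUltrametricDist (A : Matrix l m α) (B : Matrix m n α) : ‖A * B‖ ≤ ‖A‖ * ‖B‖ := by
  rw [Matrix.norm_le_iff (mul_nonneg (norm_nonneg _) (norm_nonneg _))]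
  intro i j
  rw [Matrix.mul_apply]
  refine IsUltrametricDist.norm_sum_le_of_forall_le_of_nonneg (mul_nonneg (norm_nonneg _) (norm_nonneg _)) fun k _ => ?_
  exact (norm_mul_le _ _).trans
    (mul_le_mul (Matrix.norm_entry_le_entrywise_sup_norm A) (Matrix.norm_entry_le_entrywise_sup_norm B) (norm_nonneg _) (norm_nonneg _))

/-- `‖A ^ (k+1)‖ ≤ ‖A‖ ^ (k+1)` for square matrices (elementwise norm, ultrametric coefficients). [cite: BoschGuntzerRemmert1984, §1.2.1] -/
theorem norm_pow_succ_le_of_isUltrametricDist {R : Type*} [SeminormedRing R] [IsUltrametricDist R] [DecidableEq n] (A : Matrix n n R) (k : ℕ) :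
    ‖A ^ (k + 1)‖ ≤ ‖A‖ ^ (k + 1) := by
  induction k with
  | zero => simp
  | succ k ih =>
    rw [pow_succ, pow_succ ‖A‖]
    exact (norm_mul_le_of_isUltrametricDist _ _).trans (mul_le_mul_of_nonneg_right ih (norm_nonneg _))

end SubMul

/-! ### §2 Strict derivatives under the elementwise norm: `Ring.inverse`, the Cayley transform, products, the two slice maps -/

section Calculus

variable {K : Type*} [NontriviallyNormedField K] [IsUltrametricDist K] [CompleteSpace K] {n : Type*} [Fintype n] [DecidableEq n]

/-- **`D(Ring.inverse)(u) X = −u⁻¹ X u⁻¹`, STRICTLY, at every unit `u ∈ M_n(K)`, for the ELEMENTWISE norm** (`K` complete ultrametric): Mathlib's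
`hasStrictFDerivAt_ringInverse` run under the inline `NormedRing` structure of §1 (the statement's norm instances are the scoped elementwise ones).
[cite: Schikhof1984, §27] -/
theorem hasStrictFDerivAt_ringInverse_elementwise (u : (Matrix n n K)ˣ) :
    ∃ D : Matrix n n K →L[K] Matrix n n K,
      (∀ X, D X = -(((u⁻¹ : (Matrix n n K)ˣ) : Matrix n n K) * X * ((u⁻¹ : (Matrix n n K)ˣ) : Matrix n n K))) ∧
      HasStrictFDerivAt Ring.inverse D (u : Matrix n n K) := by
  letI : NormedRing (Matrix n n K) :=
    { Matrix.normedAddCommGroup, (inferInstance : Ring (Matrix n n K)) with norm_mul_le := norm_mul_le_of_isUltrametricDist }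
  letI : NormedAlgebra K (Matrix n n K) := { (inferInstance : Algebra K (Matrix n n K)) with norm_smul_le := norm_smul_le }
  haveI : CompleteSpace (Matrix n n K) := inferInstanceAs (CompleteSpace (n → n → K))
  -- everything below is elaborated against the inline structures; the final `exact` is a definitional re-reading
  have key : ∃ D : Matrix n n K →L[K] Matrix n n K,
      (∀ X, D X = -(((u⁻¹ : (Matrix n n K)ˣ) : Matrix n n K) * X * ((u⁻¹ : (Matrix n n K)ˣ) : Matrix n n K))) ∧
      HasStrictFDerivAt Ring.inverse D (u : Matrix n n K) :=
    ⟨_, fun X => rfl, hasStrictFDerivAt_ringInverse u⟩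
  exact key

/-- **`Dc(0) = −2·id`, STRICTLY, for the Cayley transform `c(X) = (1 − X)(1 + X)⁻¹` on `M_n(K)` under the elementwise norm** (`K` complete ultrametric).
[cite: Schikhof1984, §27] -/
theorem hasStrictFDerivAt_cayley_elementwise :
    HasStrictFDerivAt (cayley : Matrix n n K → Matrix n n K) (-((2 : K) • ContinuousLinearMap.id K (Matrix n n K))) 0 := by
  letI : NormedRing (Matrix n n K) :=
    { Matrix.normedAddCommGroup, (inferInstance : Ring (Matrix n n K)) with norm_mul_le := norm_mul_le_of_isUltrametricDist }
  letI : NormedAlgebra K (Matrix n n K) := { (inferInstance : Algebra K (Matrix n n K)) with norm_smul_le := norm_smul_le }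
  haveI : CompleteSpace (Matrix n n K) := inferInstanceAs (CompleteSpace (n → n → K))
  suffices key : HasStrictFDerivAt (cayley : Matrix n n K → Matrix n n K) (-((2 : K) • ContinuousLinearMap.id K (Matrix n n K))) 0 by exact key
  have h1 : HasStrictFDerivAt (fun X : Matrix n n K => (1 : Matrix n n K) - X) (-(ContinuousLinearMap.id K (Matrix n n K))) 0 :=
    (hasStrictFDerivAt_id (𝕜 := K) (0 : Matrix n n K)).const_sub 1
  have h2 : HasStrictFDerivAt (fun X : Matrix n n K => (1 : Matrix n n K) + X) (ContinuousLinearMap.id K (Matrix n n K)) 0 :=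
    (hasStrictFDerivAt_id (𝕜 := K) (0 : Matrix n n K)).const_add 1
  have hpt : (fun X : Matrix n n K => (1 : Matrix n n K) + X) 0 = ((1 : (Matrix n n K)ˣ) : Matrix n n K) := by simp
  have hg : HasStrictFDerivAt (Ring.inverse : Matrix n n K → Matrix n n K)
      (-ContinuousLinearMap.mulLeftRight K (Matrix n n K) (((1 : (Matrix n n K)ˣ)⁻¹ : (Matrix n n K)ˣ) : Matrix n n K)
        (((1 : (Matrix n n K)ˣ)⁻¹ : (Matrix n n K)ˣ) : Matrix n n K)) ((fun X : Matrix n n K => (1 : Matrix n n K) + X) 0) := by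
    rw [hpt]; exact hasStrictFDerivAt_ringInverse (1 : (Matrix n n K)ˣ)
  have h3 := HasStrictFDerivAt.comp (f := fun X : Matrix n n K => (1 : Matrix n n K) + X) 0 hg h2
  have h := h1.mul' h3
  have hfun : ((fun X : Matrix n n K => (1 : Matrix n n K) - X) * fun x => Ring.inverse (1 + x)) = cayley := rfl
  rw [hfun] at h
  refine h.congr_fderiv (ContinuousLinearMap.ext fun H => ?_)
  -- pointwise evaluation of the product-rule derivative is definitional; only the algebra `1 − 0 = 1`, `1⁻¹ = 1` remains
  change ((1 : Matrix n n K) - 0) * (-((((1 : (Matrix n n K)ˣ)⁻¹ : (Matrix n n K)ˣ) : Matrix n n K) * H * (((1 : (Matrix n n K)ˣ)⁻¹ : (Matrix n n K)ˣ) : Matrix n n K))) +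
      (-H) * Ring.inverse ((1 : Matrix n n K) + 0) = -((2 : K) • H)
  simp only [sub_zero, add_zero, inv_one, Units.val_one, Ring.inverse_one, one_mul, mul_one]
  rw [two_smul, neg_add]

omit [CompleteSpace K] in
/-- **Product rule in `∃`-form** for two `M_n(K)`-valued maps on a normed `K`-space, under the elementwise norm (`K` ultrametric):
`D(fg)(x) v = Df(x) v · g x + f x · Dg(x) v`. [cite: Schikhof1984, §27] -/
theorem hasStrictFDerivAt_mul_elementwise {E : Type*} [NormedAddCommGroup E] [NormedSpace K E] {f g : E → Matrix n n K}
    {Df Dg : E →L[K] Matrix n n K} {x : E} (hf : HasStrictFDerivAt f Df x) (hg : HasStrictFDerivAt g Dg x) :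
    ∃ D : E →L[K] Matrix n n K, (∀ v, D v = Df v * g x + f x * Dg v) ∧ HasStrictFDerivAt (fun y => f y * g y) D x := by
  letI : NormedRing (Matrix n n K) :=
    { Matrix.normedAddCommGroup, (inferInstance : Ring (Matrix n n K)) with norm_mul_le := norm_mul_le_of_isUltrametricDist }
  letI : NormedAlgebra K (Matrix n n K) := { (inferInstance : Algebra K (Matrix n n K)) with norm_smul_le := norm_smul_le }
  have key := hf.mul' hg
  refine ⟨_, fun v => ?_, key⟩
  -- `(f x • Dg + Df <• g x) v = f x * Dg v + Df v * g x` definitionally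
  change f x * Dg v + Df v * g x = Df v * g x + f x * Dg v
  exact add_comm _ _

/-- **THE LIE-ALGEBRA SLICE MAP `Ψ(Y, Z) = c(Y)(A + Z)c(Y)⁻¹` is strictly differentiable at `(0, 0)` with derivative `(Y, Z) ↦ 2(AY − YA) + Z`**
(elementwise norm on `M_n(K) × M_n(K)`, `K` complete ultrametric; `c` the tree's Cayley transform, `Dc(0) = −2·id`, `c(0) = 1`; `c(Y)⁻¹` as `Ring.inverse`,
total).  This is the differential of Harish-Chandra's descent map to the centraliser of a semisimple `A` [HarishChandra1970, Part VI L. 22], in Cayley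
coordinates. [cite: HarishChandra1970, Part VI Lemma 22] [cite: Schikhof1984, §27] -/
theorem hasStrictFDerivAt_cayleyConj_add_elementwise (A : Matrix n n K) :
    ∃ D : (Matrix n n K × Matrix n n K) →L[K] Matrix n n K,
      (∀ Y Z : Matrix n n K, D (Y, Z) = (2 : K) • (A * Y - Y * A) + Z) ∧
      HasStrictFDerivAt (fun p : Matrix n n K × Matrix n n K => cayley p.1 * (A + p.2) * Ring.inverse (cayley p.1)) D 0 := by
  letI : NormedRing (Matrix n n K) :=
    { Matrix.normedAddCommGroup, (inferInstance : Ring (Matrix n n K)) with norm_mul_le := norm_mul_le_of_isUltrametricDist }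
  letI : NormedAlgebra K (Matrix n n K) := { (inferInstance : Algebra K (Matrix n n K)) with norm_smul_le := norm_smul_le }
  haveI : CompleteSpace (Matrix n n K) := inferInstanceAs (CompleteSpace (n → n → K))
  suffices key : ∃ D : (Matrix n n K × Matrix n n K) →L[K] Matrix n n K,
      (∀ Y Z : Matrix n n K, D (Y, Z) = (2 : K) • (A * Y - Y * A) + Z) ∧
      HasStrictFDerivAt (fun p : Matrix n n K × Matrix n n K => cayley p.1 * (A + p.2) * Ring.inverse (cayley p.1)) D 0 by exact key
  have hπ₁ : HasStrictFDerivAt (fun p : Matrix n n K × Matrix n n K => p.1) (ContinuousLinearMap.fst K (Matrix n n K) (Matrix n n K)) 0 :=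
    (ContinuousLinearMap.fst K (Matrix n n K) (Matrix n n K)).hasStrictFDerivAt
  have hπ₂ : HasStrictFDerivAt (fun p : Matrix n n K × Matrix n n K => A + p.2)
      (ContinuousLinearMap.snd K (Matrix n n K) (Matrix n n K)) 0 :=
    (ContinuousLinearMap.snd K (Matrix n n K) (Matrix n n K)).hasStrictFDerivAt.const_add A
  have hpt₁ : (fun p : Matrix n n K × Matrix n n K => p.1) 0 = 0 := rfl
  have hc₁ : HasStrictFDerivAt (cayley : Matrix n n K → Matrix n n K)
      (-((2 : K) • ContinuousLinearMap.id K (Matrix n n K))) ((fun p : Matrix n n K × Matrix n n K => p.1) 0) := by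
    rw [hpt₁]; exact hasStrictFDerivAt_cayley_elementwise
  have ha := HasStrictFDerivAt.comp (f := fun p : Matrix n n K × Matrix n n K => p.1) 0 hc₁ hπ₁
  have hptc : (cayley ∘ fun p : Matrix n n K × Matrix n n K => p.1) 0 = ((1 : (Matrix n n K)ˣ) : Matrix n n K) := by simp
  have hg : HasStrictFDerivAt (Ring.inverse : Matrix n n K → Matrix n n K)
      (-ContinuousLinearMap.mulLeftRight K (Matrix n n K) (((1 : (Matrix n n K)ˣ)⁻¹ : (Matrix n n K)ˣ) : Matrix n n K)
        (((1 : (Matrix n n K)ˣ)⁻¹ : (Matrix n n K)ˣ) : Matrix n n K))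
      ((cayley ∘ fun p : Matrix n n K × Matrix n n K => p.1) 0) := by
    rw [hptc]; exact hasStrictFDerivAt_ringInverse (1 : (Matrix n n K)ˣ)
  have hcinv := HasStrictFDerivAt.comp (f := cayley ∘ fun p : Matrix n n K × Matrix n n K => p.1) 0 hg ha
  have hΦ := (ha.mul' hπ₂).mul' hcinv
  refine ⟨_, fun Y Z => ?_, hΦ⟩
  refine (?_ : _ = cayley ((0 : Matrix n n K × Matrix n n K).1) * (A + (0 : Matrix n n K × Matrix n n K).2) *
      (-((((1 : (Matrix n n K)ˣ)⁻¹ : (Matrix n n K)ˣ) : Matrix n n K) * (-((2 : K) • Y)) *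
        (((1 : (Matrix n n K)ˣ)⁻¹ : (Matrix n n K)ˣ) : Matrix n n K))) +
      (cayley ((0 : Matrix n n K × Matrix n n K).1) * Z + (-((2 : K) • Y)) * (A + (0 : Matrix n n K × Matrix n n K).2)) *
        Ring.inverse (cayley ((0 : Matrix n n K × Matrix n n K).1))).trans ?_
  · rfl
  · simp only [Prod.fst_zero, Prod.snd_zero, cayley_zero, inv_one, Units.val_one, Ring.inverse_one, one_mul, mul_one, add_zero, mul_neg, neg_mul,
      neg_neg, two_smul, mul_add, add_mul, smul_sub]
    abel

/-- **The group-slice shape `(Y, Z) ↦ c(Y)·γc(Z)·c(Y)⁻¹`** (★ `RegularOrbitChartUnitary`∕`SemisimpleOrbitChartUnitary`'s chart map) is strictly differentiable at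
`(0, 0)` with derivative `(Y, Z) ↦ 2(γY − Yγ − γZ)`, under the ELEMENTWISE norm (`K` complete ultrametric). [cite: HarishChandra1970, Part VI Lemma 22] [cite: Schikhof1984, §27] -/
theorem hasStrictFDerivAt_cayleyConj_mul_elementwise (γ : Matrix n n K) :
    ∃ D : (Matrix n n K × Matrix n n K) →L[K] Matrix n n K,
      (∀ Y Z : Matrix n n K, D (Y, Z) = (2 : K) • (γ * Y - Y * γ - γ * Z)) ∧
      HasStrictFDerivAt (fun p : Matrix n n K × Matrix n n K => cayley p.1 * (γ * cayley p.2) * Ring.inverse (cayley p.1)) D 0 := by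
  letI : NormedRing (Matrix n n K) :=
    { Matrix.normedAddCommGroup, (inferInstance : Ring (Matrix n n K)) with norm_mul_le := norm_mul_le_of_isUltrametricDist }
  letI : NormedAlgebra K (Matrix n n K) := { (inferInstance : Algebra K (Matrix n n K)) with norm_smul_le := norm_smul_le }
  haveI : CompleteSpace (Matrix n n K) := inferInstanceAs (CompleteSpace (n → n → K))
  suffices key : ∃ D : (Matrix n n K × Matrix n n K) →L[K] Matrix n n K,
      (∀ Y Z : Matrix n n K, D (Y, Z) = (2 : K) • (γ * Y - Y * γ - γ * Z)) ∧
      HasStrictFDerivAt (fun p : Matrix n n K × Matrix n n K => cayley p.1 * (γ * cayley p.2) * Ring.inverse (cayley p.1)) D 0 by exact key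
  have hπ₁ : HasStrictFDerivAt (fun p : Matrix n n K × Matrix n n K => p.1) (ContinuousLinearMap.fst K (Matrix n n K) (Matrix n n K)) 0 :=
    (ContinuousLinearMap.fst K (Matrix n n K) (Matrix n n K)).hasStrictFDerivAt
  have hπ₂ : HasStrictFDerivAt (fun p : Matrix n n K × Matrix n n K => p.2) (ContinuousLinearMap.snd K (Matrix n n K) (Matrix n n K)) 0 :=
    (ContinuousLinearMap.snd K (Matrix n n K) (Matrix n n K)).hasStrictFDerivAt
  have hpt₁ : (fun p : Matrix n n K × Matrix n n K => p.1) 0 = 0 := rfl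
  have hpt₂ : (fun p : Matrix n n K × Matrix n n K => p.2) 0 = 0 := rfl
  have hc₁ : HasStrictFDerivAt (cayley : Matrix n n K → Matrix n n K)
      (-((2 : K) • ContinuousLinearMap.id K (Matrix n n K))) ((fun p : Matrix n n K × Matrix n n K => p.1) 0) := by
    rw [hpt₁]; exact hasStrictFDerivAt_cayley_elementwise
  have hc₂ : HasStrictFDerivAt (cayley : Matrix n n K → Matrix n n K)
      (-((2 : K) • ContinuousLinearMap.id K (Matrix n n K))) ((fun p : Matrix n n K × Matrix n n K => p.2) 0) := by
    rw [hpt₂]; exact hasStrictFDerivAt_cayley_elementwise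
  have ha := HasStrictFDerivAt.comp (f := fun p : Matrix n n K × Matrix n n K => p.1) 0 hc₁ hπ₁
  have hb := (HasStrictFDerivAt.comp (f := fun p : Matrix n n K × Matrix n n K => p.2) 0 hc₂ hπ₂).const_mul γ
  have hptc : (cayley ∘ fun p : Matrix n n K × Matrix n n K => p.1) 0 = ((1 : (Matrix n n K)ˣ) : Matrix n n K) := by simp
  have hg : HasStrictFDerivAt (Ring.inverse : Matrix n n K → Matrix n n K)
      (-ContinuousLinearMap.mulLeftRight K (Matrix n n K) (((1 : (Matrix n n K)ˣ)⁻¹ : (Matrix n n K)ˣ) : Matrix n n K)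
        (((1 : (Matrix n n K)ˣ)⁻¹ : (Matrix n n K)ˣ) : Matrix n n K))
      ((cayley ∘ fun p : Matrix n n K × Matrix n n K => p.1) 0) := by
    rw [hptc]; exact hasStrictFDerivAt_ringInverse (1 : (Matrix n n K)ˣ)
  have hcinv := HasStrictFDerivAt.comp (f := cayley ∘ fun p : Matrix n n K × Matrix n n K => p.1) 0 hg ha
  have hΦ := (ha.mul' hb).mul' hcinv
  refine ⟨_, fun Y Z => ?_, hΦ⟩
  refine (?_ : _ = cayley ((0 : Matrix n n K × Matrix n n K).1) * (γ * cayley ((0 : Matrix n n K × Matrix n n K).2)) *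
      (-((((1 : (Matrix n n K)ˣ)⁻¹ : (Matrix n n K)ˣ) : Matrix n n K) * (-((2 : K) • Y)) *
        (((1 : (Matrix n n K)ˣ)⁻¹ : (Matrix n n K)ˣ) : Matrix n n K))) +
      (cayley ((0 : Matrix n n K × Matrix n n K).1) * (γ * (-((2 : K) • Z))) +
          (-((2 : K) • Y)) * (γ * cayley ((0 : Matrix n n K × Matrix n n K).2))) *
        Ring.inverse (cayley ((0 : Matrix n n K × Matrix n n K).1))).trans ?_
  · rfl
  · simp only [Prod.fst_zero, Prod.snd_zero, cayley_zero, inv_one, Units.val_one, Ring.inverse_one, one_mul, mul_one, mul_neg, neg_mul,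
      neg_neg, two_smul, mul_add, add_mul, smul_sub]
    abel

end Calculus

/-! ### §3 Maps into a submodule: strict differentiability is read on the ambient space -/

section CodRestrict

variable {𝕜 : Type*} [NontriviallyNormedField 𝕜] {E : Type*} [NormedAddCommGroup E] [NormedSpace 𝕜 E]
  {G : Type*} [NormedAddCommGroup G] [NormedSpace 𝕜 G]

/-- **Strict differentiability of a map INTO a submodule is that of its composite with the (isometric) inclusion**:
`HasStrictFDerivAt (p.subtype ∘ f) (p.subtypeL ∘L D) x ↔ HasStrictFDerivAt f D x`. [cite: Schikhof1984, §27] -/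
theorem hasStrictFDerivAt_codRestrict_iff (p : Submodule 𝕜 G) {f : E → ↥p} {D : E →L[𝕜] ↥p} {x : E} :
    HasStrictFDerivAt (fun y => (f y : G)) (p.subtypeL.comp D) x ↔ HasStrictFDerivAt f D x := by
  rw [hasStrictFDerivAt_iff_isLittleO, hasStrictFDerivAt_iff_isLittleO]
  constructor
  · intro h
    refine Asymptotics.IsLittleO.of_norm_left ?_
    refine (Asymptotics.isLittleO_norm_left.2 h).congr' (Filter.Eventually.of_forall fun q => ?_) Filter.EventuallyEq.rfl
    simp only [ContinuousLinearMap.comp_apply, Submodule.subtypeL_apply]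
    rw [← Submodule.coe_sub, ← Submodule.coe_sub, Submodule.coe_norm]
  · intro h
    refine Asymptotics.IsLittleO.of_norm_left ?_
    refine (Asymptotics.isLittleO_norm_left.2 h).congr' (Filter.Eventually.of_forall fun q => ?_) Filter.EventuallyEq.rfl
    simp only [ContinuousLinearMap.comp_apply, Submodule.subtypeL_apply]
    rw [← Submodule.coe_sub, ← Submodule.coe_sub, Submodule.coe_norm]

end CodRestrict

end Literature.Analysis.Matrix
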